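import Literature.AlgebraicGeometry.Frobenioids.Cor411iiiOfFSMType
import Literature.AlgebraicGeometry.Frobenioids.Cor411iiAssemblyFSM
import Literature.AlgebraicGeometry.Frobenioids.Prop55Sub
import HarnessLib

/-!
# Frobenioids I, Corollary 4.11 (iii) AS TYPED (`PreFrobenioidData.Cor411iii`) — for general Frobenioids
# over bases of FSM-type, AT THE CONSTRUCTIONS, with no residual binder (FACT-LIST row F-1027)

Mochizuki, *The geometry of Frobenioids I: the general theory*, Kyushu J. Math. **62** (2008)
293–400, kurims text: Cor. 4.11 (iii) p. 92 "if, moreover, `C₁`, `C₂` are of rationally standard type, then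
there exists an isomorphism of functors `Ψ^Φ : Φ₁ ⥲ Φ₂` … lying over the equivalence `Ψ^Base : D₁ ⥲ D₂` of
(ii)"; proof p. 94 "assertion (iii) follows formally from assertion (ii); Theorem 4.9"
[cite: MochizukiFrdI2008, Cor. 4.11 (iii) p.92].

PROOF-ONLY companion of `DivisorMonoidCategoryTheoreticity.lean` (cell abc-iut, F fact-proving wave, seat
abc-iut-f-032; FACT-LIST row **F-1027** `PreFrobenioidData.Cor411iii`, [FrdI] Corollary 4.11 (iii) p. 92).
The row is a schema over the data-only interfaces `PreFrobenioidData` / `RSParams` (its universal closure is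
refuted in `DivisorMonoidCategoryTheoreticityCorSchemaNegativeB.lean`, `PreFrobenioidData.not_forall_cor411iii`);
what print asserts is the instance at THE Frobenioids and THE Def. 4.5 (iii) parameters. Everything here is
ASSEMBLED BY NAME from landed theorems, nothing is re-proved:

* `PreFrobenioid.cor411iii_rsParams_of_isOfFSMType` — for Frobenioids `C_i → F_{Φ_i}` with perf-factorial
  `Φ_i` over bases `D_i` of FSM-type (the cell's standing route to Thm. 3.4 (ii)/(iii)) and any equivalence
  `Ψ : C₁ ⥲ C₂`, the typed Cor. 4.11 (iii) HOLDS when "`C₁` of rationally standard type" is read at THE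
  parameters `rsParams hF₁ PrimarySupp` (THE birationalization of Prop. 4.4, THE unit-trivialisation of
  Prop. 3.3 (iv), THE support predicate of Def. 2.4 (i)(d); seat abc-iut-L1-d1's `PreFrobenioid.rsParams`)
  and `R₂` is arbitrary: seat abc-iut-L1-t14's `FrdI.cor411iii_of_cor411ii_of_isOfFSMType` (Thm. 4.9 by seat
  abc-iut-w4-d109's `FrdI.T49.thm49_ofFunctor_of_isOfFSMType`, descent `D^* ⥲ D` by seat abc-iut-L1-d6's
  `cor411iii_of_cor411ii_of_thm49`) has exactly two inputs beyond the typed antecedents — "`C₁` of rational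
  type at THE birationalization / support" (`hrat₁`), which IS the `rational` field of the antecedent
  `IsOfRationallyStandardType (rsParams hF₁ PrimarySupp)`, and the typed Cor. 4.11 (ii) for `Ψ`, which is
  seat abc-iut-L1-d6's `PreFrobenioid.cor411ii_ofFunctor_of_isOfFSMType`;
* `PreFrobenioid.cor411iii_holds_of_isOfFSMType` — the same with BOTH `R_i` THE constructions (the instance
  form of F-1027 the cone consumes).

Hypotheses: Frobenioids (`IsFrobenioid`), `Φ_i` perf-factorial (§4 standing hypothesis, Def. 2.4 (i)), bases
of FSM-type (in place of print's FSMFF-type: the cell's proved route to Thm. 3.4 (ii)/(iii), seat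
abc-iut-L1-t13; `IsOfFSMType.isOfFSMFFType`). No definitions; no statement of the paper is restated or
strengthened; nothing here is specific to the abc programme and no side is taken on [IUTchIII] Cor. 3.12.
-/

namespace Literature.AlgebraicGeometry.Frobenioids

open CategoryTheory Opposite

universe w v v' u u'

namespace PreFrobenioid

variable {D₁ : Type u} [Category.{v} D₁] {Φ₁ : D₁ᵒᵖ ⥤ CommMonCat.{w}} {C₁ : Type u'} [Category.{v'} C₁]
  {D₂ : Type u} [Category.{v} D₂] {Φ₂ : D₂ᵒᵖ ⥤ CommMonCat.{w}} {C₂ : Type u'} [Category.{v'} C₂]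
  {F₁ : C₁ ⥤ ElemFrobenioid Φ₁} {F₂ : C₂ ⥤ ElemFrobenioid Φ₂}

/-- **[FrdI] Cor. 4.11 (iii) AS TYPED, for general Frobenioids over bases of FSM-type, `C₁`'s Def. 4.5 (iii)
parameters THE constructions, `R₂` arbitrary — no residual binder**: for Frobenioids `C_i → F_{Φ_i}` with
perf-factorial `Φ_i` over bases of FSM-type and any equivalence `Ψ : C₁ ⥲ C₂`, under `Cor411Setting` and
"`C_i` of rationally standard type" (for `C₁` at `rsParams hF₁ PrimarySupp`), there is a `1`-unique
`Ψ^Base : D₁ ⥲ D₂` `1`-commuting with the base functors and an isomorphism `Ψ^Φ : Φ₁ ⥲ Φ₂` over it.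
Assembled from `FrdI.cor411iii_of_cor411ii_of_isOfFSMType` (its `hrat₁` is the `rational` field of the
antecedent) and `PreFrobenioid.cor411ii_ofFunctor_of_isOfFSMType` (its `h2`).
[cite: MochizukiFrdI2008, Cor. 4.11 (iii) p.92] -/
theorem cor411iii_rsParams_of_isOfFSMType (hF₁ : IsFrobenioid F₁) (hF₂ : IsFrobenioid F₂)
    (hpf₁ : Objectwise (fun M _ => IsPerfFactorial M) Φ₁) (hpf₂ : Objectwise (fun M _ => IsPerfFactorial M) Φ₂)
    (hD₁ : IsOfFSMType D₁) (hD₂ : IsOfFSMType D₂) (Ψ : C₁ ≌ C₂)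
    (R₂ : (PreFrobenioidData.ofFunctor Φ₂ F₂).RSParams) :
    (PreFrobenioidData.ofFunctor Φ₁ F₁).Cor411iii (PreFrobenioidData.ofFunctor Φ₂ F₂) Ψ
      (rsParams hF₁ fun a 𝔭 => PrimarySupp a 𝔭) R₂ :=
  fun hs hR₁ hR₂ =>
    FrdI.cor411iii_of_cor411ii_of_isOfFSMType hF₁ hF₂ hD₁ hD₂ hpf₁ hpf₂ (fun A => hR₁.rational A) Ψ _ R₂
      (cor411ii_ofFunctor_of_isOfFSMType hF₁ hF₂ Ψ hpf₁ hpf₂ hD₁ hD₂) hs hR₁ hR₂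

/-- **[FrdI] Cor. 4.11 (iii) AS TYPED, AT THE CONSTRUCTIONS, for general Frobenioids over bases of FSM-type —
the instance form of FACT-LIST row F-1027 with no residual binder**: both Def. 4.5 (iii) parameter packages
are THE constructions `rsParams hF_i PrimarySupp`. [cite: MochizukiFrdI2008, Cor. 4.11 (iii) p.92] -/
theorem cor411iii_holds_of_isOfFSMType (hF₁ : IsFrobenioid F₁) (hF₂ : IsFrobenioid F₂)
    (hpf₁ : Objectwise (fun M _ => IsPerfFactorial M) Φ₁) (hpf₂ : Objectwise (fun M _ => IsPerfFactorial M) Φ₂)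
    (hD₁ : IsOfFSMType D₁) (hD₂ : IsOfFSMType D₂) (Ψ : C₁ ≌ C₂) :
    (PreFrobenioidData.ofFunctor Φ₁ F₁).Cor411iii (PreFrobenioidData.ofFunctor Φ₂ F₂) Ψ
      (rsParams hF₁ fun a 𝔭 => PrimarySupp a 𝔭) (rsParams hF₂ fun a 𝔭 => PrimarySupp a 𝔭) :=
  cor411iii_rsParams_of_isOfFSMType hF₁ hF₂ hpf₁ hpf₂ hD₁ hD₂ Ψ _

/-- **Unpacked form** of `cor411iii_holds_of_isOfFSMType`: under `Cor411Setting` and "`C_i` of rationally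
standard type" at THE constructions, `Ψ` induces a `1`-unique base equivalence `Ψ^Base` and an isomorphism of
functors `Ψ^Φ : Φ₁ ⥲ Φ₂` lying over it ("in particular, `Ψ^Base`, `Ψ^Φ` induce an equivalence
`Ψ^F : F_{Φ₁} ⥲ F_{Φ₂}`", p. 92). [cite: MochizukiFrdI2008, Cor. 4.11 (iii) p.92] -/
theorem exists_baseSquare_divisorMonoidIsoOverBase_of_isOfFSMType (hF₁ : IsFrobenioid F₁)
    (hF₂ : IsFrobenioid F₂)
    (hpf₁ : Objectwise (fun M _ => IsPerfFactorial M) Φ₁) (hpf₂ : Objectwise (fun M _ => IsPerfFactorial M) Φ₂)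
    (hD₁ : IsOfFSMType D₁) (hD₂ : IsOfFSMType D₂) (Ψ : C₁ ≌ C₂)
    (hs : (PreFrobenioidData.ofFunctor Φ₁ F₁).Cor411Setting (PreFrobenioidData.ofFunctor Φ₂ F₂) Ψ)
    (hR₁ : (PreFrobenioidData.ofFunctor Φ₁ F₁).IsOfRationallyStandardType
      (rsParams hF₁ fun a 𝔭 => PrimarySupp a 𝔭))
    (hR₂ : (PreFrobenioidData.ofFunctor Φ₂ F₂).IsOfRationallyStandardType
      (rsParams hF₂ fun a 𝔭 => PrimarySupp a 𝔭)) :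
    ∃ ΨBase : D₁ ⥤ D₂,
      PreFrobenioidData.OneUniqueSquare Ψ.functor (PreFrobenioidData.ofFunctor Φ₁ F₁).base
          (PreFrobenioidData.ofFunctor Φ₂ F₂).base ΨBase ∧
        Nonempty ((PreFrobenioidData.ofFunctor Φ₁ F₁).DivisorMonoidIsoOverBase
          (PreFrobenioidData.ofFunctor Φ₂ F₂) ΨBase) :=
  cor411iii_holds_of_isOfFSMType hF₁ hF₂ hpf₁ hpf₂ hD₁ hD₂ Ψ hs hR₁ hR₂

end PreFrobenioid

end Literature.AlgebraicGeometry.Frobenioids
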